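import Summits.AtomisticToContinuum.BoseEinsteinCondensation.Theorems.BECThomsonPrincipleGDTransferSeededIvtGlue
import Summits.AtomisticToContinuum.BoseEinsteinCondensation.Theorems.BECThomsonPrincipleGDTransferSeededSpectralDefs

/-!
# Route `BECThomsonPrinciple`, crux `GDTransfer` (stmt-AtomisticToContinuum-9482), line `seeded-continuity`:
# the connectedness assembly POTENTIAL BY POTENTIAL (registered sub-goal `ivtGlue_for`, lead c4)

Supports (does not close) stmt-AtomisticToContinuum-9482.  The landed registered stub `stub_ivtGlue` (p138348) consumes the
seed in its global form `NoBalancedCat` (all admissible potentials at once) but uses it only at the potential at hand.  This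
file re-lands the same connectedness assembly with the seed AT ONE POTENTIAL (`NoBalancedCatFor v`, …SeededSpectralDefs) as
hypothesis — verbatim the proof of `stub_ivtGlue` with one line changed — so that per-potential seeds (in particular the
SPECTRAL seed `seedFor_of_kyFanGapFloor : … → KyFanGapFloorFor v → NoBalancedCatFor v`) compose with the landed band
emptiness, free corner and local constancy to periodic BEC for that potential.

References: LSSY2005 §1.2 (1.17)–(1.19); KennedyLiebShastry1988.
-/

noncomputable section

open MeasureTheory Filter Set Metric
open scoped ENNReal NNReal

namespace Summit.AtomisticToContinuum.BoseEinsteinCondensation.Cruxes.GDTransfer.Seeded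

open Literature.MathematicalPhysics.QuantumManyBody.BoseGas
open Summit.AtomisticToContinuum.BoseEinsteinCondensation.Theses.BECThomsonPrinciple
open Summit.AtomisticToContinuum.BoseEinsteinCondensation.Theorems.GaussianDominationCan.Negative (modeProj cellAvg)
open Summit.AtomisticToContinuum.BoseEinsteinCondensation.Cruxes.GDTransfer.DysonDressedWitness
  (PeriodicBECFor gdTransfer_iff)

/-- **The connectedness assembly at one potential** (`stub_ivtGlue` with the seed hypothesis `NoBalancedCatFor v` in place
of `NoBalancedCat`; same constants `θ = β = 1/8 → (τ, ρ₀ˢ, N₀ˢ) → η = (1−2τ)/4 →` band `→` corner; same clopen argument on the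
path of sides `[L_N, max L_N (A·N)]`). -/
theorem ivtGlue_for : CountLaw → ∀ v : ℝ → ℝ≥0∞, IsRepulsiveFiniteRange v → NoBalancedCatFor v → BandEmptiness v → FreeCorner v → LocalConstancy v → PeriodicBECFor v := by
  intro hC v hv hSeed hBand hCorner hLoc
  -- (1) constants from the seed (`θ = β = 1/8`)
  obtain ⟨τ, hτ0, hτ2, ρs, hρs, Ns, hseed⟩ :=
    hSeed (1 / 8) (1 / 8) (by norm_num) (by norm_num) (by norm_num)
  set η : ℝ := (1 - 2 * τ) / 4 with hηdef
  have hη0 : 0 < η := by rw [hηdef]; linarith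
  set τ₂ : ℝ := 1 - τ - η with hτ₂def
  have hττ₂ : τ < τ₂ := by rw [hτ₂def, hηdef]; linarith
  have hτ₂0 : 0 < τ₂ := hτ0.trans hττ₂
  set γ : ℝ := (τ₂ - τ) / 2 with hγdef
  have hγ0 : 0 < γ := by rw [hγdef]; linarith
  have hθβ : ∀ m : ℕ, (1 / 8 : ℝ) * (m + 1) ≤ (1 - 1 / 8) * (m + 1) := fun m => by
    have : (0 : ℝ) ≤ (m : ℝ) + 1 := by positivity
    nlinarith
  -- (2) band emptiness with `ε := η`
  obtain ⟨ρb, hρb, Nb, hband⟩ := hBand (1 / 8) (1 / 8) (by norm_num) (by norm_num) (by norm_num) η hη0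
  -- (3) the corner with `ε := (τ + η)/16`
  set εc : ℝ := (τ + η) / 16 with hεcdef
  have hεc0 : 0 < εc := by positivity
  obtain ⟨A, hA, Nc, hcorner⟩ := hCorner εc hεc0
  -- (4) the answer: `ρ₀ := min ρs ρb`, `c := (7/8) τ₂ / 2`
  refine ⟨min ρs ρb, lt_min hρs hρb, fun ρ hρ hρ0 => ?_⟩
  have hρs' : ρ < ρs := hρ0.trans_le (min_le_left _ _)
  have hρb' : ρ < ρb := hρ0.trans_le (min_le_right _ _)
  refine ⟨(7 / 8) * τ₂ / 2, by positivity, ?_⟩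
  filter_upwards [eventually_ge_atTop Ns, eventually_ge_atTop Nb, eventually_ge_atTop Nc,
    eventually_ge_atTop 1] with N hNs hNb hNc hN1
  obtain ⟨m, rfl⟩ : ∃ m, N = m + 1 := ⟨N - 1, by omega⟩
  -- (5) the path of sides `[L₀, Lt]`
  have hNr : (0 : ℝ) < ((m + 1 : ℕ) : ℝ) := Nat.cast_pos.2 (Nat.succ_pos m)
  set L₀ : ℝ := sideLength ρ (m + 1) with hL₀def
  have hL₀ : 0 < L₀ := Real.rpow_pos_of_pos (div_pos hNr hρ) _
  have hL₀3 : ρ * L₀ ^ 3 = ((m + 1 : ℕ) : ℝ) := by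
    rw [hL₀def, sideLength_pow_three hρ (m + 1)]
    field_simp
  set Lt : ℝ := max L₀ (A * (m + 1)) with hLtdef
  have hL₀Lt : L₀ ≤ Lt := le_max_left _ _
  have hpath : ∀ L : ℝ, L₀ ≤ L →
      0 < L ∧ ((m + 1 : ℕ) : ℝ) ≤ ρs * L ^ 3 ∧ ((m + 1 : ℕ) : ℝ) ≤ ρb * L ^ 3 := by
    intro L hL
    have hLpos : 0 < L := hL₀.trans_le hL
    have h3 : L₀ ^ 3 ≤ L ^ 3 := pow_le_pow_left₀ hL₀.le hL 3
    have hρL : ((m + 1 : ℕ) : ℝ) ≤ ρ * L ^ 3 := by rw [← hL₀3]; gcongr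
    exact ⟨hLpos, hρL.trans (by gcongr), hρL.trans (by gcongr)⟩
  -- (6) `good` / `bad` sides
  set good : ℝ → Prop := fun L => ∃ δ : ℝ≥0∞, 0 < δ ∧ ∀ Ψ : PeriodicTrialState (m + 1) L,
    periodicEnergy v Ψ ≤ periodicGroundStateEnergy v (m + 1) L + δ →
      τ₂ < (hiMass m L (1 / 8) Ψ.ψ).toReal with hgood
  set bad : ℝ → Prop := fun L => ∃ δ : ℝ≥0∞, 0 < δ ∧ ∀ Ψ : PeriodicTrialState (m + 1) L,
    periodicEnergy v Ψ ≤ periodicGroundStateEnergy v (m + 1) L + δ →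
      (hiMass m L (1 / 8) Ψ.ψ).toReal < τ with hbad
  -- (F1) every side of the path is good or bad
  have hdich : ∀ L : ℝ, L₀ ≤ L → good L ∨ bad L := by
    intro L hL
    obtain ⟨hLpos, hNs', hNb'⟩ := hpath L hL
    have hE : periodicGroundStateEnergy v (m + 1) L ≠ ⊤ := (hLoc m (1 / 8) L hLpos).1
    obtain ⟨δs, hδs, hS⟩ := hseed m hNs L hLpos hNs' hE
    obtain ⟨δb, hδb, hB⟩ := hband m hNb L hLpos hNb'
    obtain ⟨r, hr, δ₁, hδ₁, hloc⟩ := (hLoc m (1 / 8) L hLpos).2 γ hγ0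
    obtain ⟨δ', hδ', hloc'⟩ := hloc L (by rw [sub_self, abs_zero]; exact hr)
    set δ : ℝ≥0∞ := min (min δs δb) (min δ₁ δ') with hδdef
    have hδ : 0 < δ := lt_min (lt_min hδs hδb) (lt_min hδ₁ hδ')
    have hδ_s : δ ≤ δs := (min_le_left _ _).trans (min_le_left _ _)
    have hδ_b : δ ≤ δb := (min_le_left _ _).trans (min_le_right _ _)
    have hδ_1 : δ ≤ δ₁ := (min_le_right _ _).trans (min_le_left _ _)
    have hδ_' : δ ≤ δ' := (min_le_right _ _).trans (min_le_right _ _)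
    have hD : ∀ Ψ : PeriodicTrialState (m + 1) L,
        periodicEnergy v Ψ ≤ periodicGroundStateEnergy v (m + 1) L + δ →
        (hiMass m L (1 / 8) Ψ.ψ).toReal < τ ∨ τ₂ < (hiMass m L (1 / 8) Ψ.ψ).toReal := fun Ψ hΨ =>
      hi_dichotomy hC hLpos Ψ (hθβ m) hη0.le (hS Ψ (hΨ.trans (add_le_add le_rfl hδ_s)))
        (hB Ψ (hΨ.trans (add_le_add le_rfl hδ_b)))
    have hcl : ∀ Ψ Φ : PeriodicTrialState (m + 1) L,
        periodicEnergy v Ψ ≤ periodicGroundStateEnergy v (m + 1) L + δ →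
        periodicEnergy v Φ ≤ periodicGroundStateEnergy v (m + 1) L + δ →
        (hiMass m L (1 / 8) Ψ.ψ).toReal ≤ (hiMass m L (1 / 8) Φ.ψ).toReal + γ := fun Ψ Φ hΨ hΦ =>
      (hloc' Ψ Φ (hΨ.trans (add_le_add le_rfl hδ_')) (hΦ.trans (add_le_add le_rfl hδ_1))).1
    obtain ⟨Ψ₀, hΨ₀⟩ := exists_nearMin hE hδ
    rcases hD Ψ₀ hΨ₀ with h0 | h0
    · refine Or.inr ⟨δ, hδ, fun Ψ hΨ => ?_⟩
      rcases hD Ψ hΨ with h1 | h1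
      · exact h1
      · have h2 := hcl Ψ Ψ₀ hΨ hΨ₀
        exact absurd h2 (by rw [hγdef]; linarith)
    · refine Or.inl ⟨δ, hδ, fun Ψ hΨ => ?_⟩
      rcases hD Ψ hΨ with h1 | h1
      · have h2 := hcl Ψ₀ Ψ hΨ₀ hΨ
        exact absurd h2 (by rw [hγdef]; linarith)
      · exact h1
  -- (F2) no side is both
  have hexcl : ∀ L : ℝ, L₀ ≤ L → ¬ (good L ∧ bad L) := by
    rintro L hL ⟨⟨δg, hδg, hG⟩, ⟨δb', hδb', hBd⟩⟩
    obtain ⟨hLpos, -, -⟩ := hpath L hL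
    have hE : periodicGroundStateEnergy v (m + 1) L ≠ ⊤ := (hLoc m (1 / 8) L hLpos).1
    obtain ⟨Ψ, hΨ⟩ := exists_nearMin hE (lt_min hδg hδb')
    linarith [hG Ψ (hΨ.trans (add_le_add le_rfl (min_le_left _ _))),
      hBd Ψ (hΨ.trans (add_le_add le_rfl (min_le_right _ _)))]
  -- (F3) `good` is locally constant along the path
  have hlc : ∀ L₁ : ℝ, L₁ ∈ Icc L₀ Lt → ∃ r : ℝ, 0 < r ∧ ∀ L' : ℝ, L' ∈ Icc L₀ Lt →
      |L' - L₁| < r → (good L' ↔ good L₁) := by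
    intro L₁ hL₁
    obtain ⟨hL₁pos, -, -⟩ := hpath L₁ hL₁.1
    have hE₁ : periodicGroundStateEnergy v (m + 1) L₁ ≠ ⊤ := (hLoc m (1 / 8) L₁ hL₁pos).1
    obtain ⟨r, hr, δ₁, hδ₁, hloc⟩ := (hLoc m (1 / 8) L₁ hL₁pos).2 γ hγ0
    refine ⟨r, hr, fun L' hL' hdist => ?_⟩
    obtain ⟨hL'pos, -, -⟩ := hpath L' hL'.1
    have hE' : periodicGroundStateEnergy v (m + 1) L' ≠ ⊤ := (hLoc m (1 / 8) L' hL'pos).1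
    obtain ⟨δ', hδ', hloc'⟩ := hloc L' hdist
    constructor
    · intro hgL'
      rcases hdich L₁ hL₁.1 with hg1 | hb1
      · exact hg1
      · exfalso
        obtain ⟨δg, hδg, hG⟩ := hgL'
        obtain ⟨δb1, hδb1, hBd⟩ := hb1
        obtain ⟨Ψ', hΨ'⟩ := exists_nearMin hE' (lt_min hδ' hδg)
        obtain ⟨Ψ₁, hΨ₁⟩ := exists_nearMin hE₁ (lt_min hδ₁ hδb1)
        have hc := (hloc' Ψ' Ψ₁ (hΨ'.trans (add_le_add le_rfl (min_le_left _ _)))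
          (hΨ₁.trans (add_le_add le_rfl (min_le_left _ _)))).1
        have h1 := hG Ψ' (hΨ'.trans (add_le_add le_rfl (min_le_right _ _)))
        have h2 := hBd Ψ₁ (hΨ₁.trans (add_le_add le_rfl (min_le_right _ _)))
        rw [hγdef] at hc
        linarith
    · intro hg1
      rcases hdich L' hL'.1 with hgL' | hbL'
      · exact hgL'
      · exfalso
        obtain ⟨δg, hδg, hG⟩ := hg1
        obtain ⟨δb2, hδb2, hBd⟩ := hbL'
        obtain ⟨Ψ', hΨ'⟩ := exists_nearMin hE' (lt_min hδ' hδb2)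
        obtain ⟨Ψ₁, hΨ₁⟩ := exists_nearMin hE₁ (lt_min hδ₁ hδg)
        have hc := (hloc' Ψ' Ψ₁ (hΨ'.trans (add_le_add le_rfl (min_le_left _ _)))
          (hΨ₁.trans (add_le_add le_rfl (min_le_left _ _)))).2
        have h1 := hG Ψ₁ (hΨ₁.trans (add_le_add le_rfl (min_le_right _ _)))
        have h2 := hBd Ψ' (hΨ'.trans (add_le_add le_rfl (min_le_right _ _)))
        rw [hγdef] at hc
        linarith
  -- (F4) the top side is good (free corner)
  have hgoodtop : good Lt := by
    obtain ⟨hLtpos, -, -⟩ := hpath Lt hL₀Lt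
    obtain ⟨δc, hδc, hcΨ⟩ := hcorner m hNc Lt (le_max_right _ _)
    refine ⟨δc, hδc, fun Ψ hΨ => ?_⟩
    have hmean := mean_add_le hC hLtpos Ψ (by norm_num : (0 : ℝ) ≤ 1 / 8)
    have hcor := hcΨ Ψ hΨ
    -- `N/8 · rest ≤ εc N`
    have hn0top : condensateOccupation (m + 1) Lt Ψ.ψ ≠ ⊤ :=
      ne_top_of_le_ne_top (ENNReal.natCast_ne_top (m + 1)) (le_self_add.trans hmean)
    have hrest := ENNReal.le_of_add_le_add_left hn0top (hmean.trans hcor)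
    have hrest_top : lawMass m Lt (fun j => ¬ ((1 - 1 / 8) * (m + 1) ≤ (j : ℝ))) Ψ.ψ ≠ ⊤ :=
      lawMass_ne_top hC hLtpos Ψ _
    have hreal := ENNReal.toReal_mono ENNReal.ofReal_ne_top hrest
    rw [ENNReal.toReal_mul, ENNReal.toReal_ofReal (by positivity), ENNReal.toReal_ofReal (by positivity),
      lawMass_not_hi_toReal hC hLtpos Ψ (1 / 8)] at hreal
    -- `hreal : 1/8 (m+1) (1 − hi') ≤ εc (m+1)`
    have hm0 : (0 : ℝ) < (m : ℝ) + 1 := by positivity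
    have h1 : 1 - (hiMass m Lt (1 / 8) Ψ.ψ).toReal ≤ 8 * εc := by
      by_contra hcon
      rw [not_le] at hcon
      have : εc * ((m : ℝ) + 1) < 1 / 8 * ((m : ℝ) + 1) * (1 - (hiMass m Lt (1 / 8) Ψ.ψ).toReal) := by
        nlinarith
      linarith
    rw [hεcdef] at h1
    rw [hτ₂def]
    linarith
  -- (F5) the bottom side is good: connectedness of `[L₀, Lt]`
  have hgood0 : good L₀ := by
    by_contra hbad0
    choose! r hr0 hr using hlc
    set U : Set ℝ := ⋃ L' ∈ {L' : ℝ | L' ∈ Icc L₀ Lt ∧ good L'}, ball L' (r L') with hU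
    set V : Set ℝ := ⋃ L' ∈ {L' : ℝ | L' ∈ Icc L₀ Lt ∧ ¬ good L'}, ball L' (r L') with hV
    have hUo : IsOpen U := isOpen_biUnion fun _ _ => isOpen_ball
    have hVo : IsOpen V := isOpen_biUnion fun _ _ => isOpen_ball
    have hcover : Icc L₀ Lt ⊆ U ∪ V := by
      intro L' hL'
      by_cases hg : good L'
      · exact Or.inl (mem_biUnion (show L' ∈ {L' : ℝ | L' ∈ Icc L₀ Lt ∧ good L'} from ⟨hL', hg⟩)
          (mem_ball_self (hr0 L' hL')))
      · exact Or.inr (mem_biUnion (show L' ∈ {L' : ℝ | L' ∈ Icc L₀ Lt ∧ ¬ good L'} from ⟨hL', hg⟩)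
          (mem_ball_self (hr0 L' hL')))
    have hLtP : Lt ∈ Icc L₀ Lt := ⟨hL₀Lt, le_rfl⟩
    have hL₀P : L₀ ∈ Icc L₀ Lt := ⟨le_rfl, hL₀Lt⟩
    have hUne : (Icc L₀ Lt ∩ U).Nonempty :=
      ⟨Lt, hLtP, mem_biUnion (show Lt ∈ {L' : ℝ | L' ∈ Icc L₀ Lt ∧ good L'} from ⟨hLtP, hgoodtop⟩)
        (mem_ball_self (hr0 Lt hLtP))⟩
    have hVne : (Icc L₀ Lt ∩ V).Nonempty :=
      ⟨L₀, hL₀P, mem_biUnion (show L₀ ∈ {L' : ℝ | L' ∈ Icc L₀ Lt ∧ ¬ good L'} from ⟨hL₀P, hbad0⟩)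
        (mem_ball_self (hr0 L₀ hL₀P))⟩
    obtain ⟨L'', hL''P, hL''U, hL''V⟩ := isPreconnected_Icc U V hUo hVo hcover hUne hVne
    rw [hU, mem_iUnion₂] at hL''U
    rw [hV, mem_iUnion₂] at hL''V
    obtain ⟨La, ⟨hLaP, hLa⟩, haL⟩ := hL''U
    obtain ⟨Lb, ⟨hLbP, hLb⟩, hbL⟩ := hL''V
    rw [mem_ball, Real.dist_eq] at haL hbL
    have h1 : good L'' := (hr La hLaP L'' hL''P haL).mpr hLa
    exact hLb ((hr Lb hLbP L'' hL''P hbL).mp h1)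
  -- (F6) conclusion at `L₀ = sideLength ρ (m+1)`
  obtain ⟨δg, hδg, hG⟩ := hgood0
  refine ⟨δg, hδg, fun Ψ hΨ => ?_⟩
  have hhi : ENNReal.ofReal τ₂ ≤ hiMass m L₀ (1 / 8) Ψ.ψ :=
    ENNReal.ofReal_le_of_le_toReal (hG Ψ hΨ).le
  calc ENNReal.ofReal ((7 / 8) * τ₂ / 2 * ((m + 1 : ℕ) : ℝ))
      ≤ ENNReal.ofReal ((1 - 1 / 8) * (m + 1)) * ENNReal.ofReal τ₂ := by
        rw [← ENNReal.ofReal_mul (by positivity)]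
        refine ENNReal.ofReal_le_ofReal ?_
        push_cast
        nlinarith
    _ ≤ ENNReal.ofReal ((1 - 1 / 8) * (m + 1)) * hiMass m L₀ (1 / 8) Ψ.ψ := by gcongr
    _ ≤ condensateOccupation (m + 1) L₀ Ψ.ψ := hi_mul_le_mean hC hL₀ Ψ (1 / 8)

end Summit.AtomisticToContinuum.BoseEinsteinCondensation.Cruxes.GDTransfer.Seeded

end
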